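import Mathlib

/-!
# Crux `CubicForrelation.NearExactIsExact` (stmt-QuantumAdvantage-14043) — n = 12, WEIGHT OF A TYPE-O CUBIC, case R4: the ARITHMETIC CORE
  (part A — cells, relations, trace, certificates T0–T4)

Certificate seat `b2b-cforr-cert` (gen 32).  HONEST FRAMING: a pure finite arithmetic lemma (standard axioms, no `decide` on large types, no
`native_decide`); it is the combinatorial heart of "a cubic Boolean function on 12 bits with weight `≡ 8 (mod 16)` has weight `≥ 1280`"
(…TwelveOddWeight*), which kills the "`κ₁` type O" branch of the wild (O,O) analysis of the open window `(57/64, 29/32)`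
(PLAN-N12-WINDOW-OO.md §5–6).  NOT summit progress; no value of `θ₁₂` by itself.

Setting (established geometrically in …TwelveOddWeightR4): a cubic `κ` with a derivative `D_aκ = z₁z₂ ⊕ z₃z₄` (weight `1536`) splits
`𝔽₂¹²` into `32` cells (7-flats) labelled by `ζ ∈ 𝔽₂⁴` (the values of the four forms, cell index `k = Σ ζᵢ2ⁱ < 16`) and a side bit;
`s k` is the number of ones of `κ` in cell `k` on side `0`; on side `1` the cell carries `s k` ones if `π(k) = k₀k₁ ⊕ k₂k₃ = 0` and
`128 − s k` otherwise, so `wt(κ) = 768 + 2·Σ_{π(k)=0} s k`.  A pair of "dual vectors" `0 < m₁ < m₂ < 16` and bits `c₁, c₂` cut out the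
union of four cells `{k : m₁·k = c₁, m₂·k = c₂}` (a 9-flat on each side).  Hypotheses: `4 ∣ s k ≤ 128`; the residue `mod 8` of a 9-flat
count does not depend on `(c₁, c₂)` (TYPE PRINCIPLE, …TwelveOddWeightFlatType); a 9-flat count `≡ 4 (mod 8)` is `≥ 132` on both sides
(Kasami–Tokura on 9-flats); `Σ_{π=0} s ≡ 4 (mod 8)` (`wt κ ≡ 8 mod 16`).  Conclusion (…ArithB, `tow_r4_arith`): `Σ_{π(k)=0} s k ≥ 268`.
Method: the residues of the six coordinate planes are the bits of an alternating form; `wt ≡ 8 (16)` is a trace condition; for each of the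
`32` admissible residue patterns three 9-flats (two plain, one on side `1`) tile the ten cells `{π = 0}` (LP certificates found by computer,
`HOME/code/cert-g32/cert_search.py`; the Lean proof is by `omega`).

References: T. Kasami, N. Tokura (1970); F. J. MacWilliams, N. J. A. Sloane (1977) Ch. 15.  Axioms: the standard three.
-/

set_option linter.dupNamespace false -- D-0017: single-problem summit ⇒ `QuantumAdvantage.QuantumAdvantage` by design

namespace Summit.QuantumAdvantage.QuantumAdvantage.Theorems.CubicForrelation.NearExactIsExact

open Finset

/-- `m·k` over `𝔽₂` for two 4-bit numbers (local notation, not a definition). -/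
local notation3 (prettyPrint := false) "𝕚" m:max k:max =>
  ((Nat.testBit m 0 && Nat.testBit k 0) ^^ (Nat.testBit m 1 && Nat.testBit k 1) ^^
    (Nat.testBit m 2 && Nat.testBit k 2) ^^ (Nat.testBit m 3 && Nat.testBit k 3))

/-- `π(k) = k₀k₁ ⊕ k₂k₃`, the pattern of the rank-4 derivative on the cells (local notation). -/
local notation3 (prettyPrint := false) "πq" k:max =>
  ((Nat.testBit k 0 && Nat.testBit k 1) ^^ (Nat.testBit k 2 && Nat.testBit k 3))

/-- The side-`0` count of the union of cells `{k : m₁·k = c₁, m₂·k = c₂}` (local notation). -/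
local notation3 (prettyPrint := false) "CS" s:max m₁:max m₂:max c₁:max c₂:max =>
  (∑ k ∈ Finset.range 16, if (𝕚 m₁ k = c₁ ∧ 𝕚 m₂ k = c₂) then s k else 0)

/-- The side-`1` count of the same union (local notation). -/
local notation3 (prettyPrint := false) "CT" s:max m₁:max m₂:max c₁:max c₂:max =>
  (∑ k ∈ Finset.range 16, if (𝕚 m₁ k = c₁ ∧ 𝕚 m₂ k = c₂) then (if πq k = true then 128 - s k else s k) else 0)

/-- The side-`0` count of the ten cells with `π(k) = 0` (local notation). -/
local notation3 (prettyPrint := false) "ZS" s:max => (∑ k ∈ Finset.range 16, if πq k = false then s k else 0)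

/-- The sixteen cell facts `4 ∣ s k ≤ 128`, unpacked for `omega`. [this work] -/
theorem tow_r4_cells (s : ℕ → ℕ) (hD : ∀ k, k < 16 → 4 ∣ s k) (hB : ∀ k, k < 16 → s k ≤ 128) :
    (4 ∣ s 0 ∧ 4 ∣ s 1 ∧ 4 ∣ s 2 ∧ 4 ∣ s 3 ∧ 4 ∣ s 4 ∧ 4 ∣ s 5 ∧ 4 ∣ s 6 ∧ 4 ∣ s 7 ∧ 4 ∣ s 8 ∧ 4 ∣ s 9 ∧ 4 ∣ s 10 ∧ 4 ∣ s 11 ∧ 4 ∣ s 12 ∧ 4 ∣ s 13 ∧ 4 ∣ s 14 ∧ 4 ∣ s 15) ∧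
      (s 0 ≤ 128 ∧ s 1 ≤ 128 ∧ s 2 ≤ 128 ∧ s 3 ≤ 128 ∧ s 4 ≤ 128 ∧ s 5 ≤ 128 ∧ s 6 ≤ 128 ∧ s 7 ≤ 128 ∧ s 8 ≤ 128 ∧ s 9 ≤ 128 ∧ s 10 ≤ 128 ∧ s 11 ≤ 128 ∧ s 12 ≤ 128 ∧ s 13 ≤ 128 ∧ s 14 ≤ 128 ∧ s 15 ≤ 128) :=
  ⟨⟨hD 0 (by norm_num), hD 1 (by norm_num), hD 2 (by norm_num), hD 3 (by norm_num), hD 4 (by norm_num), hD 5 (by norm_num), hD 6 (by norm_num), hD 7 (by norm_num), hD 8 (by norm_num), hD 9 (by norm_num), hD 10 (by norm_num), hD 11 (by norm_num), hD 12 (by norm_num), hD 13 (by norm_num), hD 14 (by norm_num), hD 15 (by norm_num)⟩,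
    ⟨hB 0 (by norm_num), hB 1 (by norm_num), hB 2 (by norm_num), hB 3 (by norm_num), hB 4 (by norm_num), hB 5 (by norm_num), hB 6 (by norm_num), hB 7 (by norm_num), hB 8 (by norm_num), hB 9 (by norm_num), hB 10 (by norm_num), hB 11 (by norm_num), hB 12 (by norm_num), hB 13 (by norm_num), hB 14 (by norm_num), hB 15 (by norm_num)⟩⟩

/-- The five linear relations among cell residues: the counts of the coordinate 3-cubes `{k₃=0}, {k₂=0}, {k₁=0}, {k₀=0}` and of all
sixteen cells are `≡ 0 (mod 8)` (each is a union of two 9-flats with equal residues). [this work] -/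
theorem tow_r4_rels (s : ℕ → ℕ) (hD : ∀ k, k < 16 → 4 ∣ s k)
    (hR : ∀ m₁ m₂ : ℕ, 0 < m₁ → m₁ < m₂ → m₂ < 16 → ∀ c₁ c₂ : Bool, CS s m₁ m₂ c₁ c₂ % 8 = CS s m₁ m₂ false false % 8) :
    (s 0 + s 1 + s 2 + s 3 + s 4 + s 5 + s 6 + s 7) % 8 = 0 ∧
      (s 0 + s 1 + s 2 + s 3 + s 8 + s 9 + s 10 + s 11) % 8 = 0 ∧
      (s 0 + s 1 + s 4 + s 5 + s 8 + s 9 + s 12 + s 13) % 8 = 0 ∧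
      (s 0 + s 2 + s 4 + s 6 + s 8 + s 10 + s 12 + s 14) % 8 = 0 ∧
      (s 0 + s 1 + s 2 + s 3 + s 4 + s 5 + s 6 + s 7 + s 8 + s 9 + s 10 + s 11 + s 12 + s 13 + s 14 + s 15) % 8 = 0 := by
  have d0 := hD 0 (by norm_num)
  have d1 := hD 1 (by norm_num)
  have d2 := hD 2 (by norm_num)
  have d3 := hD 3 (by norm_num)
  have d4 := hD 4 (by norm_num)
  have d5 := hD 5 (by norm_num)
  have d6 := hD 6 (by norm_num)
  have d7 := hD 7 (by norm_num)
  have d8 := hD 8 (by norm_num)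
  have d9 := hD 9 (by norm_num)
  have d10 := hD 10 (by norm_num)
  have d11 := hD 11 (by norm_num)
  have d12 := hD 12 (by norm_num)
  have d13 := hD 13 (by norm_num)
  have d14 := hD 14 (by norm_num)
  have d15 := hD 15 (by norm_num)
  have a1 := hR 4 8 (by norm_num) (by norm_num) (by norm_num) true false
  have a2 := hR 4 8 (by norm_num) (by norm_num) (by norm_num) false true
  have a3 := hR 4 8 (by norm_num) (by norm_num) (by norm_num) true true
  have a4 := hR 2 8 (by norm_num) (by norm_num) (by norm_num) false true
  have a5 := hR 1 8 (by norm_num) (by norm_num) (by norm_num) false true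
  simp (config := { decide := true }) only [Finset.sum_range_succ, Finset.sum_range_zero, ite_true, ite_false,
    zero_add, add_zero] at a1 a2 a3 a4 a5
  omega

/-- **Trace condition.**  `Σ_{π=0} s ≡ 4 (mod 8)` (i.e. `wt κ ≡ 8 mod 16`) forces the residues of the two coordinate planes
`{k₂=k₃=0}` and `{k₀=k₁=0}` to differ: their sum is `≡ 4 (mod 8)`. [this work] -/
theorem tow_r4_trace (s : ℕ → ℕ) (hD : ∀ k, k < 16 → 4 ∣ s k)
    (hR : ∀ m₁ m₂ : ℕ, 0 < m₁ → m₁ < m₂ → m₂ < 16 → ∀ c₁ c₂ : Bool, CS s m₁ m₂ c₁ c₂ % 8 = CS s m₁ m₂ false false % 8)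
    (hO : ZS s % 8 = 4) :
    ((s 0 + s 1 + s 2 + s 3) + (s 0 + s 4 + s 8 + s 12)) % 8 = 4 := by
  have d0 := hD 0 (by norm_num)
  have d1 := hD 1 (by norm_num)
  have d2 := hD 2 (by norm_num)
  have d3 := hD 3 (by norm_num)
  have d4 := hD 4 (by norm_num)
  have d5 := hD 5 (by norm_num)
  have d6 := hD 6 (by norm_num)
  have d7 := hD 7 (by norm_num)
  have d8 := hD 8 (by norm_num)
  have d9 := hD 9 (by norm_num)
  have d10 := hD 10 (by norm_num)
  have d11 := hD 11 (by norm_num)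
  have d12 := hD 12 (by norm_num)
  have d13 := hD 13 (by norm_num)
  have d14 := hD 14 (by norm_num)
  have d15 := hD 15 (by norm_num)
  obtain ⟨r1, r2, r3, r4, r5⟩ := tow_r4_rels s hD hR
  simp (config := { decide := true }) only [Finset.sum_range_succ, Finset.sum_range_zero, ite_true, ite_false,
    zero_add, add_zero] at hO
  omega

/-- Certificate `T0`: if the planes of the three 9-flats (plain 9-flat on cells (0, 1, 6, 7); plain 9-flat on cells (2, 4, 9, 15); side-1 9-flat on cells (5, 7, 8, 10)) are odd — hypotheses `h₁ h₂ h₃` state this through the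
coordinate-plane residues — then `Σ_{π=0} s ≥ 268`. [this work] -/
theorem tow_r4_T0 (s : ℕ → ℕ) (hD : ∀ k, k < 16 → 4 ∣ s k) (hB : ∀ k, k < 16 → s k ≤ 128)
    (hR : ∀ m₁ m₂ : ℕ, 0 < m₁ → m₁ < m₂ → m₂ < 16 → ∀ c₁ c₂ : Bool, CS s m₁ m₂ c₁ c₂ % 8 = CS s m₁ m₂ false false % 8)
    (hK : ∀ m₁ m₂ : ℕ, 0 < m₁ → m₁ < m₂ → m₂ < 16 → ∀ c₁ c₂ : Bool, CS s m₁ m₂ c₁ c₂ % 8 = 4 → 132 ≤ CS s m₁ m₂ c₁ c₂)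
    (hK' : ∀ m₁ m₂ : ℕ, 0 < m₁ → m₁ < m₂ → m₂ < 16 → ∀ c₁ c₂ : Bool, CS s m₁ m₂ c₁ c₂ % 8 = 4 → 132 ≤ CT s m₁ m₂ c₁ c₂)
    (h1 : ((s 0 + s 1 + s 2 + s 3) + (s 0 + s 1 + s 4 + s 5)) % 8 = 4)
    (h2 : ((s 0 + s 1 + s 2 + s 3) + (s 0 + s 1 + s 4 + s 5) + (s 0 + s 2 + s 4 + s 6) + (s 0 + s 2 + s 8 + s 10) + (s 0 + s 4 + s 8 + s 12)) % 8 = 4)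
    (h3 : ((s 0 + s 1 + s 2 + s 3) + (s 0 + s 2 + s 4 + s 6) + (s 0 + s 2 + s 8 + s 10)) % 8 = 4) :
    268 ≤ ZS s := by
  obtain ⟨⟨d0, d1, d2, d3, d4, d5, d6, d7, d8, d9, d10, d11, d12, d13, d14, d15⟩, -⟩ := tow_r4_cells s hD hB
  obtain ⟨r1, r2, r3, r4, r5⟩ := tow_r4_rels s hD hR
  have k1 := hK 6 8 (by norm_num) (by norm_num) (by norm_num) false false
  simp (config := { decide := true }) only [Finset.sum_range_succ, Finset.sum_range_zero, ite_true, ite_false,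
    zero_add, add_zero] at k1
  have p1 : (s 0 + s 1 + s 6 + s 7) % 8 = 4 := by clear * - h1 r1 d0 d1; omega
  have c1 : (s 0 + s 1 + s 6 + s 7) % 8 = 4 := p1
  have q1 := k1 c1
  have l2 := hR 7 9 (by norm_num) (by norm_num) (by norm_num) true false
  simp (config := { decide := true }) only [Finset.sum_range_succ, Finset.sum_range_zero, ite_true, ite_false,
    zero_add, add_zero] at l2
  have k2 := hK 7 9 (by norm_num) (by norm_num) (by norm_num) true false
  simp (config := { decide := true }) only [Finset.sum_range_succ, Finset.sum_range_zero, ite_true, ite_false,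
    zero_add, add_zero] at k2
  have p2 : (s 0 + s 6 + s 11 + s 13) % 8 = 4 := by clear * - h2 r2 r3 d0 d2 d4 d6 d9; omega
  have c2 : (s 2 + s 4 + s 9 + s 15) % 8 = 4 := by clear * - p2 l2; omega
  have q2 := k2 c2
  have l3 := hR 5 9 (by norm_num) (by norm_num) (by norm_num) false true
  simp (config := { decide := true }) only [Finset.sum_range_succ, Finset.sum_range_zero, ite_true, ite_false,
    zero_add, add_zero] at l3
  have k3 := hK' 5 9 (by norm_num) (by norm_num) (by norm_num) false true
  simp (config := { decide := true }) only [Finset.sum_range_succ, Finset.sum_range_zero, ite_true, ite_false,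
    zero_add, add_zero] at k3
  have p3 : (s 0 + s 2 + s 13 + s 15) % 8 = 4 := by clear * - h3 r1 r2 r4 r5 d1 d3 d4 d5 d6 d7 d8 d9 d10 d11 d12 d14; omega
  have c3 : (s 5 + s 7 + s 8 + s 10) % 8 = 4 := by clear * - p3 l3; omega
  have q3 := k3 c3
  have b7 := hB 7 (by norm_num)
  show 268 ≤ ZS s
  simp (config := { decide := true }) only [Finset.sum_range_succ, Finset.sum_range_zero, ite_true, ite_false,
    zero_add, add_zero]
  clear * - q1 q2 q3 b7
  omega

/-- Certificate `T1`: if the planes of the three 9-flats (plain 9-flat on cells (0, 1, 2, 3); plain 9-flat on cells (4, 5, 8, 9); side-1 9-flat on cells (3, 6, 10, 15)) are odd — hypotheses `h₁ h₂ h₃` state this through the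
coordinate-plane residues — then `Σ_{π=0} s ≥ 268`. [this work] -/
theorem tow_r4_T1 (s : ℕ → ℕ) (hD : ∀ k, k < 16 → 4 ∣ s k) (hB : ∀ k, k < 16 → s k ≤ 128)
    (hR : ∀ m₁ m₂ : ℕ, 0 < m₁ → m₁ < m₂ → m₂ < 16 → ∀ c₁ c₂ : Bool, CS s m₁ m₂ c₁ c₂ % 8 = CS s m₁ m₂ false false % 8)
    (hK : ∀ m₁ m₂ : ℕ, 0 < m₁ → m₁ < m₂ → m₂ < 16 → ∀ c₁ c₂ : Bool, CS s m₁ m₂ c₁ c₂ % 8 = 4 → 132 ≤ CS s m₁ m₂ c₁ c₂)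
    (hK' : ∀ m₁ m₂ : ℕ, 0 < m₁ → m₁ < m₂ → m₂ < 16 → ∀ c₁ c₂ : Bool, CS s m₁ m₂ c₁ c₂ % 8 = 4 → 132 ≤ CT s m₁ m₂ c₁ c₂)
    (h1 : ((s 0 + s 1 + s 2 + s 3)) % 8 = 4)
    (h2 : ((s 0 + s 1 + s 4 + s 5) + (s 0 + s 1 + s 8 + s 9)) % 8 = 4)
    (h3 : ((s 0 + s 1 + s 4 + s 5) + (s 0 + s 1 + s 8 + s 9) + (s 0 + s 4 + s 8 + s 12)) % 8 = 4) :
    268 ≤ ZS s := by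
  obtain ⟨⟨d0, d1, d2, d3, d4, d5, d6, d7, d8, d9, d10, d11, d12, d13, d14, d15⟩, -⟩ := tow_r4_cells s hD hB
  obtain ⟨r1, r2, r3, r4, r5⟩ := tow_r4_rels s hD hR
  have k1 := hK 4 8 (by norm_num) (by norm_num) (by norm_num) false false
  simp (config := { decide := true }) only [Finset.sum_range_succ, Finset.sum_range_zero, ite_true, ite_false,
    zero_add, add_zero] at k1
  have p1 : (s 0 + s 1 + s 2 + s 3) % 8 = 4 := by clear * - h1 d0 d1 d2 d3; omega
  have c1 : (s 0 + s 1 + s 2 + s 3) % 8 = 4 := p1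
  have q1 := k1 c1
  have l2 := hR 2 12 (by norm_num) (by norm_num) (by norm_num) false true
  simp (config := { decide := true }) only [Finset.sum_range_succ, Finset.sum_range_zero, ite_true, ite_false,
    zero_add, add_zero] at l2
  have k2 := hK 2 12 (by norm_num) (by norm_num) (by norm_num) false true
  simp (config := { decide := true }) only [Finset.sum_range_succ, Finset.sum_range_zero, ite_true, ite_false,
    zero_add, add_zero] at k2
  have p2 : (s 0 + s 1 + s 12 + s 13) % 8 = 4 := by clear * - h2 r3 d0 d1; omega
  have c2 : (s 4 + s 5 + s 8 + s 9) % 8 = 4 := by clear * - p2 l2; omega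
  have q2 := k2 c2
  have l3 := hR 2 13 (by norm_num) (by norm_num) (by norm_num) true true
  simp (config := { decide := true }) only [Finset.sum_range_succ, Finset.sum_range_zero, ite_true, ite_false,
    zero_add, add_zero] at l3
  have k3 := hK' 2 13 (by norm_num) (by norm_num) (by norm_num) true true
  simp (config := { decide := true }) only [Finset.sum_range_succ, Finset.sum_range_zero, ite_true, ite_false,
    zero_add, add_zero] at k3
  have p3 : (s 0 + s 5 + s 9 + s 12) % 8 = 4 := by clear * - h3 d0 d1 d4 d5 d8 d9 d12; omega
  have c3 : (s 3 + s 6 + s 10 + s 15) % 8 = 4 := by clear * - p3 l3; omega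
  have q3 := k3 c3
  have b3 := hB 3 (by norm_num)
  show 268 ≤ ZS s
  simp (config := { decide := true }) only [Finset.sum_range_succ, Finset.sum_range_zero, ite_true, ite_false,
    zero_add, add_zero]
  clear * - q1 q2 q3 b3
  omega

/-- Certificate `T2`: if the planes of the three 9-flats (plain 9-flat on cells (0, 1, 8, 9); plain 9-flat on cells (4, 5, 6, 7); side-1 9-flat on cells (2, 7, 10, 15)) are odd — hypotheses `h₁ h₂ h₃` state this through the
coordinate-plane residues — then `Σ_{π=0} s ≥ 268`. [this work] -/
theorem tow_r4_T2 (s : ℕ → ℕ) (hD : ∀ k, k < 16 → 4 ∣ s k) (hB : ∀ k, k < 16 → s k ≤ 128)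
    (hR : ∀ m₁ m₂ : ℕ, 0 < m₁ → m₁ < m₂ → m₂ < 16 → ∀ c₁ c₂ : Bool, CS s m₁ m₂ c₁ c₂ % 8 = CS s m₁ m₂ false false % 8)
    (hK : ∀ m₁ m₂ : ℕ, 0 < m₁ → m₁ < m₂ → m₂ < 16 → ∀ c₁ c₂ : Bool, CS s m₁ m₂ c₁ c₂ % 8 = 4 → 132 ≤ CS s m₁ m₂ c₁ c₂)
    (hK' : ∀ m₁ m₂ : ℕ, 0 < m₁ → m₁ < m₂ → m₂ < 16 → ∀ c₁ c₂ : Bool, CS s m₁ m₂ c₁ c₂ % 8 = 4 → 132 ≤ CT s m₁ m₂ c₁ c₂)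
    (h1 : ((s 0 + s 1 + s 8 + s 9)) % 8 = 4)
    (h2 : ((s 0 + s 1 + s 2 + s 3)) % 8 = 4)
    (h3 : ((s 0 + s 1 + s 8 + s 9) + (s 0 + s 4 + s 8 + s 12)) % 8 = 4) :
    268 ≤ ZS s := by
  obtain ⟨⟨d0, d1, d2, d3, d4, d5, d6, d7, d8, d9, d10, d11, d12, d13, d14, d15⟩, -⟩ := tow_r4_cells s hD hB
  obtain ⟨r1, r2, r3, r4, r5⟩ := tow_r4_rels s hD hR
  have k1 := hK 2 4 (by norm_num) (by norm_num) (by norm_num) false false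
  simp (config := { decide := true }) only [Finset.sum_range_succ, Finset.sum_range_zero, ite_true, ite_false,
    zero_add, add_zero] at k1
  have p1 : (s 0 + s 1 + s 8 + s 9) % 8 = 4 := by clear * - h1 d0 d1 d8 d9; omega
  have c1 : (s 0 + s 1 + s 8 + s 9) % 8 = 4 := p1
  have q1 := k1 c1
  have l2 := hR 4 8 (by norm_num) (by norm_num) (by norm_num) true false
  simp (config := { decide := true }) only [Finset.sum_range_succ, Finset.sum_range_zero, ite_true, ite_false,
    zero_add, add_zero] at l2
  have k2 := hK 4 8 (by norm_num) (by norm_num) (by norm_num) true false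
  simp (config := { decide := true }) only [Finset.sum_range_succ, Finset.sum_range_zero, ite_true, ite_false,
    zero_add, add_zero] at k2
  have p2 : (s 0 + s 1 + s 2 + s 3) % 8 = 4 := by clear * - h2 d0 d1 d2 d3; omega
  have c2 : (s 4 + s 5 + s 6 + s 7) % 8 = 4 := by clear * - p2 l2; omega
  have q2 := k2 c2
  have l3 := hR 2 5 (by norm_num) (by norm_num) (by norm_num) true false
  simp (config := { decide := true }) only [Finset.sum_range_succ, Finset.sum_range_zero, ite_true, ite_false,
    zero_add, add_zero] at l3
  have k3 := hK' 2 5 (by norm_num) (by norm_num) (by norm_num) true false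
  simp (config := { decide := true }) only [Finset.sum_range_succ, Finset.sum_range_zero, ite_true, ite_false,
    zero_add, add_zero] at k3
  have p3 : (s 0 + s 5 + s 8 + s 13) % 8 = 4 := by clear * - h3 r3 d0 d8; omega
  have c3 : (s 2 + s 7 + s 10 + s 15) % 8 = 4 := by clear * - p3 l3; omega
  have q3 := k3 c3
  have b7 := hB 7 (by norm_num)
  show 268 ≤ ZS s
  simp (config := { decide := true }) only [Finset.sum_range_succ, Finset.sum_range_zero, ite_true, ite_false,
    zero_add, add_zero]
  clear * - q1 q2 q3 b7
  omega

/-- Certificate `T3`: if the planes of the three 9-flats (plain 9-flat on cells (0, 1, 2, 3); plain 9-flat on cells (4, 6, 8, 10); side-1 9-flat on cells (3, 5, 9, 15)) are odd — hypotheses `h₁ h₂ h₃` state this through the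
coordinate-plane residues — then `Σ_{π=0} s ≥ 268`. [this work] -/
theorem tow_r4_T3 (s : ℕ → ℕ) (hD : ∀ k, k < 16 → 4 ∣ s k) (hB : ∀ k, k < 16 → s k ≤ 128)
    (hR : ∀ m₁ m₂ : ℕ, 0 < m₁ → m₁ < m₂ → m₂ < 16 → ∀ c₁ c₂ : Bool, CS s m₁ m₂ c₁ c₂ % 8 = CS s m₁ m₂ false false % 8)
    (hK : ∀ m₁ m₂ : ℕ, 0 < m₁ → m₁ < m₂ → m₂ < 16 → ∀ c₁ c₂ : Bool, CS s m₁ m₂ c₁ c₂ % 8 = 4 → 132 ≤ CS s m₁ m₂ c₁ c₂)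
    (hK' : ∀ m₁ m₂ : ℕ, 0 < m₁ → m₁ < m₂ → m₂ < 16 → ∀ c₁ c₂ : Bool, CS s m₁ m₂ c₁ c₂ % 8 = 4 → 132 ≤ CT s m₁ m₂ c₁ c₂)
    (h1 : ((s 0 + s 1 + s 2 + s 3)) % 8 = 4)
    (h2 : ((s 0 + s 2 + s 4 + s 6) + (s 0 + s 2 + s 8 + s 10)) % 8 = 4)
    (h3 : ((s 0 + s 2 + s 4 + s 6) + (s 0 + s 2 + s 8 + s 10) + (s 0 + s 4 + s 8 + s 12)) % 8 = 4) :
    268 ≤ ZS s := by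
  obtain ⟨⟨d0, d1, d2, d3, d4, d5, d6, d7, d8, d9, d10, d11, d12, d13, d14, d15⟩, -⟩ := tow_r4_cells s hD hB
  obtain ⟨r1, r2, r3, r4, r5⟩ := tow_r4_rels s hD hR
  have k1 := hK 4 8 (by norm_num) (by norm_num) (by norm_num) false false
  simp (config := { decide := true }) only [Finset.sum_range_succ, Finset.sum_range_zero, ite_true, ite_false,
    zero_add, add_zero] at k1
  have p1 : (s 0 + s 1 + s 2 + s 3) % 8 = 4 := by clear * - h1 d0 d1 d2 d3; omega
  have c1 : (s 0 + s 1 + s 2 + s 3) % 8 = 4 := p1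
  have q1 := k1 c1
  have l2 := hR 1 12 (by norm_num) (by norm_num) (by norm_num) false true
  simp (config := { decide := true }) only [Finset.sum_range_succ, Finset.sum_range_zero, ite_true, ite_false,
    zero_add, add_zero] at l2
  have k2 := hK 1 12 (by norm_num) (by norm_num) (by norm_num) false true
  simp (config := { decide := true }) only [Finset.sum_range_succ, Finset.sum_range_zero, ite_true, ite_false,
    zero_add, add_zero] at k2
  have p2 : (s 0 + s 2 + s 12 + s 14) % 8 = 4 := by clear * - h2 r4 d0 d2; omega
  have c2 : (s 4 + s 6 + s 8 + s 10) % 8 = 4 := by clear * - p2 l2; omega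
  have q2 := k2 c2
  have l3 := hR 1 14 (by norm_num) (by norm_num) (by norm_num) true true
  simp (config := { decide := true }) only [Finset.sum_range_succ, Finset.sum_range_zero, ite_true, ite_false,
    zero_add, add_zero] at l3
  have k3 := hK' 1 14 (by norm_num) (by norm_num) (by norm_num) true true
  simp (config := { decide := true }) only [Finset.sum_range_succ, Finset.sum_range_zero, ite_true, ite_false,
    zero_add, add_zero] at k3
  have p3 : (s 0 + s 6 + s 10 + s 12) % 8 = 4 := by clear * - h3 d0 d2 d4 d6 d8 d10 d12; omega
  have c3 : (s 3 + s 5 + s 9 + s 15) % 8 = 4 := by clear * - p3 l3; omega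
  have q3 := k3 c3
  have b3 := hB 3 (by norm_num)
  show 268 ≤ ZS s
  simp (config := { decide := true }) only [Finset.sum_range_succ, Finset.sum_range_zero, ite_true, ite_false,
    zero_add, add_zero]
  clear * - q1 q2 q3 b3
  omega

/-- Certificate `T4`: if the planes of the three 9-flats (plain 9-flat on cells (0, 2, 8, 10); plain 9-flat on cells (4, 5, 6, 7); side-1 9-flat on cells (1, 7, 9, 15)) are odd — hypotheses `h₁ h₂ h₃` state this through the
coordinate-plane residues — then `Σ_{π=0} s ≥ 268`. [this work] -/
theorem tow_r4_T4 (s : ℕ → ℕ) (hD : ∀ k, k < 16 → 4 ∣ s k) (hB : ∀ k, k < 16 → s k ≤ 128)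
    (hR : ∀ m₁ m₂ : ℕ, 0 < m₁ → m₁ < m₂ → m₂ < 16 → ∀ c₁ c₂ : Bool, CS s m₁ m₂ c₁ c₂ % 8 = CS s m₁ m₂ false false % 8)
    (hK : ∀ m₁ m₂ : ℕ, 0 < m₁ → m₁ < m₂ → m₂ < 16 → ∀ c₁ c₂ : Bool, CS s m₁ m₂ c₁ c₂ % 8 = 4 → 132 ≤ CS s m₁ m₂ c₁ c₂)
    (hK' : ∀ m₁ m₂ : ℕ, 0 < m₁ → m₁ < m₂ → m₂ < 16 → ∀ c₁ c₂ : Bool, CS s m₁ m₂ c₁ c₂ % 8 = 4 → 132 ≤ CT s m₁ m₂ c₁ c₂)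
    (h1 : ((s 0 + s 2 + s 8 + s 10)) % 8 = 4)
    (h2 : ((s 0 + s 1 + s 2 + s 3)) % 8 = 4)
    (h3 : ((s 0 + s 2 + s 8 + s 10) + (s 0 + s 4 + s 8 + s 12)) % 8 = 4) :
    268 ≤ ZS s := by
  obtain ⟨⟨d0, d1, d2, d3, d4, d5, d6, d7, d8, d9, d10, d11, d12, d13, d14, d15⟩, -⟩ := tow_r4_cells s hD hB
  obtain ⟨r1, r2, r3, r4, r5⟩ := tow_r4_rels s hD hR
  have k1 := hK 1 4 (by norm_num) (by norm_num) (by norm_num) false false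
  simp (config := { decide := true }) only [Finset.sum_range_succ, Finset.sum_range_zero, ite_true, ite_false,
    zero_add, add_zero] at k1
  have p1 : (s 0 + s 2 + s 8 + s 10) % 8 = 4 := by clear * - h1 d0 d2 d8 d10; omega
  have c1 : (s 0 + s 2 + s 8 + s 10) % 8 = 4 := p1
  have q1 := k1 c1
  have l2 := hR 4 8 (by norm_num) (by norm_num) (by norm_num) true false
  simp (config := { decide := true }) only [Finset.sum_range_succ, Finset.sum_range_zero, ite_true, ite_false,
    zero_add, add_zero] at l2
  have k2 := hK 4 8 (by norm_num) (by norm_num) (by norm_num) true false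
  simp (config := { decide := true }) only [Finset.sum_range_succ, Finset.sum_range_zero, ite_true, ite_false,
    zero_add, add_zero] at k2
  have p2 : (s 0 + s 1 + s 2 + s 3) % 8 = 4 := by clear * - h2 d0 d1 d2 d3; omega
  have c2 : (s 4 + s 5 + s 6 + s 7) % 8 = 4 := by clear * - p2 l2; omega
  have q2 := k2 c2
  have l3 := hR 1 6 (by norm_num) (by norm_num) (by norm_num) true false
  simp (config := { decide := true }) only [Finset.sum_range_succ, Finset.sum_range_zero, ite_true, ite_false,
    zero_add, add_zero] at l3
  have k3 := hK' 1 6 (by norm_num) (by norm_num) (by norm_num) true false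
  simp (config := { decide := true }) only [Finset.sum_range_succ, Finset.sum_range_zero, ite_true, ite_false,
    zero_add, add_zero] at k3
  have p3 : (s 0 + s 6 + s 8 + s 14) % 8 = 4 := by clear * - h3 r4 d0 d8; omega
  have c3 : (s 1 + s 7 + s 9 + s 15) % 8 = 4 := by clear * - p3 l3; omega
  have q3 := k3 c3
  have b7 := hB 7 (by norm_num)
  show 268 ≤ ZS s
  simp (config := { decide := true }) only [Finset.sum_range_succ, Finset.sum_range_zero, ite_true, ite_false,
    zero_add, add_zero]
  clear * - q1 q2 q3 b7
  omega

end Summit.QuantumAdvantage.QuantumAdvantage.Theorems.CubicForrelation.NearExactIsExact
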